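import Summits.ABC.StewartYu.DescentSetupQ
import Summits.ABC.StewartYu.PadicMulticubic
import HarnessLib

/-!
# Cell abc-stewartyu, W80Two (iii): the `q = 3` descent in the sign-free set-up — triadic classes,
# re-indexing `λ = ε + 3μ`, and the place-free THIRD-POINT identity

`Summits/ABC/StewartYu/DescentThirdQ.lean` — cell `abc-stewartyu` (HOME
`run/shared/lean/pub/abc-stewartyu/`, seat lit; route `PadicPrimesW80TwoThirds`, crux `W80Two`
stmt-ABC-19486).  Plain definitions and theorems; no named fact.

The `2`-adic member of the Theorem-A family descends through CUBE roots (Yu's `q = 3` for `p = 2`,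
[Yu 1990 (2.1)], [Yu 1989 §3]): at the third point `s/3` the value of the unknown `u` is the
monomial `∏ᵢ tᵢ^{expnᵢ(u,s)}` in the principal cube roots `tᵢ` (`tᵢ³ = allᵢ`; `PadicTwoValues`),
and the descent sorts the unknowns into the `3^{d+1}` classes `expn(u,s) mod 3`.  This file is the
base-`3` twin of the "place-free half-point identity" section of p3's `DescentSetupQ.lean`
(`qEh`, `Sset`, `prod_root_pow_expn`, `sum_half_eq_evL_classVec`, `reidx`, `qEh_reidx`), written
on lit's multicubic algebra `Multicub.mono3 / ev3` (`PadicMulticubic.lean`) in place of p3's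
multiquadratic `Multiquad.monoL / evL`:

* `cls3 u s : Fin (d+1) → Fin 3` — the triadic class `expn(u,s) mod 3`; `qEt u s = ∏ allᵢ^{⌊expnᵢ/3⌋}`
  (the rational part of the third-point value), `qEt_ne`, `abs_qEt` (bridge to the flattening);
* `reidx3 ε ε_θ v = (ρ, ε + 3μ)`, `third`, `third_reidx3`, `reidx3_third`, `flat_expn_reidx3`,
  `Kfac3`, **`qEt_reidx3`**: `qEt(ε + 3μ, s) = Kfac3(ε,s) · qE(μ, s)`, `cls3_reidx3` (the class of a
  re-indexed unknown depends only on the residue `ε` and on `s`);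
* **`prod_cbrt_pow_expn`**: in ANY field `L ⊇ ℚ` with `tᵢ³ = allᵢ`,
  `∏ᵢ tᵢ^{expnᵢ(u,s)} = qEt(u,s) · mono3 t (cls3 u s)`;
* `classVec3 box p c s κ = ∑_{u ∈ box, cls3 u s = κ} p(u) · c(u) · qEt(u,s)` (any rational weights
  `c(u)` — the third step takes `c = qΔ₃ · qA`), **`sum_prod_cbrt_pow_eq_ev3`**:
  `∑_u p(u) c(u) ∏ᵢ tᵢ^{expnᵢ} = ev3 t (classVec3 …)`, the size `sum_abs_classVec3_le`, the
  denominator `classVec3_den`, and **the separation** `classVec3_eq_zero_of_ev3_eq_zero`: under the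
  cube-Kummer condition on the generators (no `∏ allⱼ^{κⱼ}` with some `κⱼ ≢ 0 (mod 3)` is a
  rational cube — lit's `not_cube_prod_pow_primes_sq_rat` for `allⱼ = qⱼ²`), a vanishing third-point
  value forces ALL `3^{d+1}` class sums to vanish (`Multicub.ev3_ne_zero`).

Nothing here is claimed to be in print beyond the shape of Yu's `q`-descent; everything is
[folklore] book-keeping.

## References
* [Yu1989] K. Yu, *Linear forms in p-adic logarithms*, Acta Arith. 53 (1989), §3 (the `q`-descent).
* [Yu1990] K. Yu, *Linear forms in p-adic logarithms II*, Compositio Math. 74 (1990), (2.1), §2.4.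
* [CijsouwWaldschmidt1977] P. L. Cijsouw, M. Waldschmidt, Compositio Math. 34 (1977), §4 (p. 189–190).
-/

noncomputable section

open Finset
open Literature.NumberTheory.Transcendental
open Literature.NumberTheory.Transcendental.CW77
open Literature.NumberTheory.Transcendental.CW77.Setup (Idx Tau tauNorm)

namespace Summit.ABC.StewartYu

namespace SetupQ

variable (Q : SetupQ) {h Lb : ℕ}

/-! ### Triadic classes and the rational part of the value at a third point -/

/-- **The triadic class** of the unknown `u` at the point `s`: `expn(u,s) mod 3`, a vector in
`{0,1,2}^{d+1}`. [cite: Yu1989, §3] -/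
def cls3 (u : Idx Q.d h Lb) (s : ℕ) : Fin (Q.d + 1) → Fin 3 :=
  fun i => ⟨Q.flat.expn u s i % 3, Nat.mod_lt _ (by norm_num)⟩

/-- Components of `cls3`. [folklore] -/
@[simp] theorem cls3_val (u : Idx Q.d h Lb) (s : ℕ) (i : Fin (Q.d + 1)) :
    ((Q.cls3 u s i : Fin 3) : ℕ) = Q.flat.expn u s i % 3 := rfl

/-- **The rational part of the third-point value**: `qEt(u,s) = ∏ᵢ allᵢ^{⌊expnᵢ(u,s)/3⌋}` (signed).
[cite: Yu1989, §3] -/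
def qEt (u : Idx Q.d h Lb) (s : ℕ) : ℚ := ∏ i, Q.all i ^ (Q.flat.expn u s i / 3)

/-- `qEt ≠ 0`. [folklore] -/
theorem qEt_ne (u : Idx Q.d h Lb) (s : ℕ) : Q.qEt u s ≠ 0 :=
  prod_ne_zero_iff.mpr fun i _ => pow_ne_zero _ (Q.all_ne i)

/-- **Bridge to the flattening**: `|qEt(u,s)| = ∏ᵢ all♭ᵢ^{⌊expnᵢ/3⌋}` (`all♭ = |all|`), by which the
archimedean size of `qEt` is read off the positive frame. [folklore] -/
theorem abs_qEt (u : Idx Q.d h Lb) (s : ℕ) :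
    |Q.qEt u s| = ∏ i, Q.flat.all i ^ (Q.flat.expn u s i / 3) := by
  unfold qEt
  rw [abs_prod]
  exact prod_congr rfl fun i _ => by rw [abs_pow, Q.flat_all]

/-- `0 < |qEt|`. [folklore] -/
theorem abs_qEt_pos (u : Idx Q.d h Lb) (s : ℕ) : 0 < |Q.qEt u s| := abs_pos.mpr (Q.qEt_ne u s)

/-- **`qEt³ · ∏ᵢ allᵢ^{expnᵢ mod 3} = qE`**: cubing the rational part and restoring the residues gives
the integer-point core (`3⌊n/3⌋ + (n mod 3) = n`). [folklore] -/
theorem qEt_pow_three_mul_prod (u : Idx Q.d h Lb) (s : ℕ) :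
    Q.qEt u s ^ 3 * ∏ i, Q.all i ^ (Q.flat.expn u s i % 3) = Q.qE u s := by
  rw [Q.qE_eq_prod_all]
  unfold qEt
  rw [← prod_pow, ← prod_mul_distrib]
  refine prod_congr rfl fun i _ => ?_
  rw [← pow_mul, ← pow_add]
  congr 1
  have := Nat.div_add_mod (Q.flat.expn u s i) 3
  omega

/-! ### Re-indexing `λ = ε + 3μ` -/

/-- **The triadic re-indexing map** `μ ↦ ε + 3μ` (`ρ` unchanged). [cite: Yu1989, §3] -/
def reidx3 (ε : Fin Q.d → ℕ) (εθ : ℕ) (v : Idx Q.d h Lb) : Idx Q.d h Lb :=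
  (v.1, (fun j => ε j + 3 * v.2.1 j, εθ + 3 * v.2.2))

/-- The map `λ ↦ ⌊λ/3⌋`. [folklore] -/
def third (u : Idx Q.d h Lb) : Idx Q.d h Lb := (u.1, (fun j => u.2.1 j / 3, u.2.2 / 3))

/-- Components of `reidx3`. [folklore] -/
@[simp] theorem reidx3_fst (ε : Fin Q.d → ℕ) (εθ : ℕ) (v : Idx Q.d h Lb) :
    (Q.reidx3 ε εθ v).1 = v.1 := rfl

/-- Components of `reidx3`. [folklore] -/
@[simp] theorem reidx3_snd_fst (ε : Fin Q.d → ℕ) (εθ : ℕ) (v : Idx Q.d h Lb) (j : Fin Q.d) :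
    (Q.reidx3 ε εθ v).2.1 j = ε j + 3 * v.2.1 j := rfl

/-- Components of `reidx3`. [folklore] -/
@[simp] theorem reidx3_snd_snd (ε : Fin Q.d → ℕ) (εθ : ℕ) (v : Idx Q.d h Lb) :
    (Q.reidx3 ε εθ v).2.2 = εθ + 3 * v.2.2 := rfl

/-- `third (reidx3 v) = v` for residues `≤ 2`. [folklore] -/
theorem third_reidx3 {ε : Fin Q.d → ℕ} {εθ : ℕ} (hε : ∀ j, ε j ≤ 2) (hεθ : εθ ≤ 2)
    (v : Idx Q.d h Lb) : Q.third (Q.reidx3 ε εθ v) = v := by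
  unfold third reidx3
  rcases v with ⟨ρ, μ, μθ⟩
  simp only [Prod.mk.injEq, true_and]
  refine ⟨funext fun j => ?_, ?_⟩
  · have := hε j; omega
  · omega

/-- `reidx3 (third u) = u` when `u` has the residues `ε` modulo `3`. [folklore] -/
theorem reidx3_third {ε : Fin Q.d → ℕ} {εθ : ℕ} (u : Idx Q.d h Lb) (hu : ∀ j, u.2.1 j % 3 = ε j)
    (huθ : u.2.2 % 3 = εθ) : Q.reidx3 ε εθ (Q.third u) = u := by
  unfold third reidx3
  rcases u with ⟨ρ, lam, lamθ⟩
  dsimp only at hu huθ ⊢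
  simp only [Prod.mk.injEq, true_and]
  refine ⟨funext fun j => ?_, ?_⟩
  · have := hu j; have := Nat.div_add_mod (lam j) 3; omega
  · have := Nat.div_add_mod lamθ 3; omega

/-- `reidx3` is injective. [folklore] -/
theorem reidx3_injective (ε : Fin Q.d → ℕ) (εθ : ℕ) :
    Function.Injective (Q.reidx3 (h := h) (Lb := Lb) ε εθ) := by
  intro v w hvw
  have h1 := congrArg Prod.fst hvw
  have h2 := fun j => congrFun (congrArg (fun u : Idx Q.d h Lb => u.2.1) hvw) j
  have h3 := congrArg (fun u : Idx Q.d h Lb => u.2.2) hvw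
  simp only [reidx3_fst, reidx3_snd_fst, reidx3_snd_snd] at h1 h2 h3
  refine Prod.ext h1 (Prod.ext (funext fun j => ?_) ?_)
  · have := h2 j; omega
  · omega

/-- **The exponents of a re-indexed unknown**: `expnᵢ(ε + 3μ, s) = εᵢ s + 3 · expnᵢ(μ, s)`.
[folklore] -/
theorem flat_expn_reidx3 (ε : Fin Q.d → ℕ) (εθ : ℕ) (v : Idx Q.d h Lb) (s : ℕ) (i : Fin (Q.d + 1)) :
    Q.flat.expn (Q.reidx3 ε εθ v) s i = Q.flat.resVec ε εθ i * s + 3 * Q.flat.expn v s i := by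
  refine Fin.lastCases ?_ (fun j => ?_) i
  · rw [Q.flat_expn_last, Q.flat_expn_last, Q.flat_resVec_last, Q.reidx3_snd_snd]; ring
  · rw [Q.flat_expn_castSucc, Q.flat_expn_castSucc, Q.flat_resVec_castSucc, Q.reidx3_snd_fst]; ring

/-- **The class of a re-indexed unknown depends only on `(ε, s)`**: `cls3 (ε + 3μ) s = (εᵢ s mod 3)ᵢ`.
[cite: Yu1989, §3] -/
theorem cls3_reidx3 (ε : Fin Q.d → ℕ) (εθ : ℕ) (v : Idx Q.d h Lb) (s : ℕ) (i : Fin (Q.d + 1)) :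
    ((Q.cls3 (Q.reidx3 ε εθ v) s i : Fin 3) : ℕ) = Q.flat.resVec ε εθ i * s % 3 := by
  rw [Q.cls3_val, Q.flat_expn_reidx3, Nat.add_mul_mod_self_left]

/-- The constant factor `Kfac3 = ∏ᵢ allᵢ^{⌊εᵢ s/3⌋}` pulled out of `qEt` after re-indexing. [folklore] -/
def Kfac3 (ε : Fin Q.d → ℕ) (εθ s : ℕ) : ℚ := ∏ i : Fin (Q.d + 1), Q.all i ^ (Q.flat.resVec ε εθ i * s / 3)

/-- `Kfac3 ≠ 0`. [folklore] -/
theorem Kfac3_ne (ε : Fin Q.d → ℕ) (εθ s : ℕ) : Q.Kfac3 ε εθ s ≠ 0 :=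
  prod_ne_zero_iff.mpr fun i _ => pow_ne_zero _ (Q.all_ne i)

/-- **`qEt(ε + 3μ, s) = Kfac3(ε, s) · qE(μ, s)`** (`⌊(εs + 3n)/3⌋ = ⌊εs/3⌋ + n`): after re-indexing, the
third-point cores are the INTEGER-point cores of the new unknowns, up to a constant. [cite: Yu1989, §3] -/
theorem qEt_reidx3 (ε : Fin Q.d → ℕ) (εθ : ℕ) (v : Idx Q.d h Lb) (s : ℕ) :
    Q.qEt (Q.reidx3 ε εθ v) s = Q.Kfac3 ε εθ s * Q.qE v s := by
  unfold qEt Kfac3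
  rw [Q.qE_eq_prod_all, ← prod_mul_distrib]
  refine prod_congr rfl fun i _ => ?_
  rw [Q.flat_expn_reidx3, ← pow_add]
  congr 1
  rw [Nat.add_mul_div_left _ _ (by norm_num : 0 < 3)]

/-! ### The place-free third-point identity -/

section ThirdPoint

variable {L : Type*} [Field L] [CharZero L]

omit [CharZero L] in
/-- `r^n = (r³)^{⌊n/3⌋} · r^{n mod 3}`. [folklore] -/
theorem pow_eq_pow_div_three_mul (r : L) (n : ℕ) : r ^ n = (r ^ 3) ^ (n / 3) * r ^ (n % 3) := by
  rw [← pow_mul, ← pow_add]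
  congr 1
  have := Nat.div_add_mod n 3
  omega

/-- **`∏ᵢ tᵢ^{expnᵢ(u,s)} = qEt(u,s) · mono3 t (cls3 u s)`** for cube roots `tᵢ³ = allᵢ` in any field of
characteristic zero: the value of the unknown `u` at the third point `s/3` splits into its rational
part and the class monomial. [cite: Yu1989, §3] -/
theorem prod_cbrt_pow_expn (t : Fin (Q.d + 1) → L) (ht : ∀ i, t i ^ 3 = (Q.all i : L))
    (u : Idx Q.d h Lb) (s : ℕ) :
    ∏ i, t i ^ Q.flat.expn u s i = (Q.qEt u s : L) * Multicub.mono3 t (Q.cls3 u s) := by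
  unfold qEt Multicub.mono3
  rw [Rat.cast_prod, ← prod_mul_distrib]
  refine prod_congr rfl fun i _ => ?_
  rw [pow_eq_pow_div_three_mul (t i), ht i, Rat.cast_pow, Q.cls3_val]

/-- **The triadic class sums** with rational weights `c(u)`: the coefficient of the class monomial
`mono3 t κ` in `∑_u p(u) c(u) ∏ᵢ tᵢ^{expnᵢ(u,s)}` (the third step takes `c = qΔ₃ · qA`). [cite: Yu1989, §3] -/
def classVec3 (box : Finset (Idx Q.d h Lb)) (p : Idx Q.d h Lb → ℤ) (c : Idx Q.d h Lb → ℚ) (s : ℕ)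
    (κ : Fin (Q.d + 1) → Fin 3) : ℚ :=
  ∑ u ∈ box with Q.cls3 u s = κ, (p u : ℚ) * (c u * Q.qEt u s)

/-- **The value at a third point is the evaluation of the class sums**:
`∑_{u ∈ box} p(u) c(u) ∏ᵢ tᵢ^{expnᵢ(u,s)} = ev3 t (classVec3 box p c s)`. [cite: Yu1989, §3] -/
theorem sum_prod_cbrt_pow_eq_ev3 (t : Fin (Q.d + 1) → L) (ht : ∀ i, t i ^ 3 = (Q.all i : L))
    (box : Finset (Idx Q.d h Lb)) (p : Idx Q.d h Lb → ℤ) (c : Idx Q.d h Lb → ℚ) (s : ℕ) :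
    ∑ u ∈ box, (p u : L) * (c u : L) * ∏ i, t i ^ Q.flat.expn u s i =
      Multicub.ev3 t (Q.classVec3 box p c s) := by
  classical
  unfold Multicub.ev3 classVec3
  have hfib : ∑ u ∈ box, (p u : L) * (c u : L) * ∏ i, t i ^ Q.flat.expn u s i =
      ∑ u ∈ box, ((p u : ℚ) * (c u * Q.qEt u s) : ℚ) * Multicub.mono3 t (Q.cls3 u s) := by
    refine sum_congr rfl fun u _ => ?_
    rw [Q.prod_cbrt_pow_expn t ht]; push_cast; ring
  rw [hfib, ← Finset.sum_fiberwise box (fun u => Q.cls3 u s)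
    (fun u => (((p u : ℚ) * (c u * Q.qEt u s) : ℚ) : L) * Multicub.mono3 t (Q.cls3 u s))]
  refine sum_congr rfl fun κ _ => ?_
  rw [Rat.cast_sum, sum_mul]
  refine sum_congr rfl fun u hu => ?_
  rw [(Finset.mem_filter.mp hu).2]

/-- `∑_κ |classVec3(κ)| ≤ ∑_u |p(u)| · |c(u) qEt(u,s)|`. [folklore] -/
theorem sum_abs_classVec3_le (box : Finset (Idx Q.d h Lb)) (p : Idx Q.d h Lb → ℤ)
    (c : Idx Q.d h Lb → ℚ) (s : ℕ) :
    ∑ κ, |(Q.classVec3 box p c s κ : ℝ)| ≤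
      ∑ u ∈ box, |(p u : ℝ)| * |((c u * Q.qEt u s : ℚ) : ℝ)| := by
  classical
  unfold classVec3
  push_cast
  calc ∑ κ, |∑ u ∈ box with Q.cls3 u s = κ, (p u : ℝ) * ((c u : ℝ) * (Q.qEt u s : ℝ))|
      ≤ ∑ κ, ∑ u ∈ box with Q.cls3 u s = κ, |(p u : ℝ) * ((c u : ℝ) * (Q.qEt u s : ℝ))| :=
        sum_le_sum fun κ _ => abs_sum_le_sum_abs _ _
    _ = ∑ u ∈ box, |(p u : ℝ) * ((c u : ℝ) * (Q.qEt u s : ℝ))| :=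
        Finset.sum_fiberwise box (fun u => Q.cls3 u s) _
    _ = ∑ u ∈ box, |(p u : ℝ)| * |(c u : ℝ) * (Q.qEt u s : ℝ)| :=
        sum_congr rfl fun u _ => abs_mul _ _

/-- **Denominators of the class sums**: a common denominator of the weights `c(u) qEt(u,s)` on the
box is one of every class sum. [folklore] -/
theorem classVec3_den (box : Finset (Idx Q.d h Lb)) (p : Idx Q.d h Lb → ℤ) (c : Idx Q.d h Lb → ℚ)
    (s : ℕ) {D : ℕ} (hD : ∀ u ∈ box, ∃ z : ℤ, (D : ℚ) * (c u * Q.qEt u s) = z)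
    (κ : Fin (Q.d + 1) → Fin 3) : ∃ z : ℤ, (D : ℚ) * Q.classVec3 box p c s κ = z := by
  classical
  unfold classVec3
  rw [mul_sum]
  have key : ∀ u ∈ box.filter (fun u => Q.cls3 u s = κ),
      ∃ z : ℤ, (D : ℚ) * ((p u : ℚ) * (c u * Q.qEt u s)) = z := by
    intro u hu
    obtain ⟨z, hz⟩ := hD u (Finset.mem_filter.mp hu).1
    exact ⟨p u * z, by push_cast; rw [← hz]; ring⟩
  choose! z hz using key
  refine ⟨∑ u ∈ box.filter (fun u => Q.cls3 u s = κ), z u, ?_⟩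
  push_cast
  exact sum_congr rfl fun u hu => hz u hu

/-- The class sum of a class not met by the support of `p` vanishes. [folklore] -/
theorem classVec3_eq_zero_of_forall (box : Finset (Idx Q.d h Lb)) (p : Idx Q.d h Lb → ℤ)
    (c : Idx Q.d h Lb → ℚ) (s : ℕ) (κ : Fin (Q.d + 1) → Fin 3)
    (hκ : ∀ u ∈ box, Q.cls3 u s = κ → p u = 0) : Q.classVec3 box p c s κ = 0 := by
  classical
  unfold classVec3
  refine sum_eq_zero fun u hu => ?_
  obtain ⟨hub, huκ⟩ := Finset.mem_filter.mp hu
  rw [hκ u hub huκ, Int.cast_zero, zero_mul]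

/-- **Separation at a third point** (cube-Kummer): if no `∏ allⱼ^{κⱼ}` with some `κⱼ ≢ 0 (mod 3)`
is a rational cube, then a vanishing value `ev3 t (classVec3 …) = 0` forces EVERY class sum to
vanish — the `3^{d+1}` class monomials are `ℚ`-linearly independent (`Multicub.ev3_ne_zero`).
[cite: Yu1989, §3] -/
theorem classVec3_eq_zero_of_ev3_eq_zero
    (hind : ∀ κ : Fin (Q.d + 1) → ℕ, (∃ j, ¬ 3 ∣ κ j) → ∀ γ : ℚ, ∏ j, Q.all j ^ κ j ≠ γ ^ 3)
    (t : Fin (Q.d + 1) → L) (ht : ∀ i, t i ^ 3 = (Q.all i : L))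
    (box : Finset (Idx Q.d h Lb)) (p : Idx Q.d h Lb → ℤ) (c : Idx Q.d h Lb → ℚ) (s : ℕ)
    (h0 : Multicub.ev3 t (Q.classVec3 box p c s) = 0) : Q.classVec3 box p c s = 0 := by
  by_contra hne
  exact Multicub.ev3_ne_zero Q.all hind t ht hne h0

/-- **Separation, unknown by unknown**: under cube-Kummer, if the third-point value vanishes then for
every class `κ` the weighted sum over the unknowns of that class vanishes. [cite: Yu1989, §3] -/
theorem classSum_eq_zero_of_sum_eq_zero
    (hind : ∀ κ : Fin (Q.d + 1) → ℕ, (∃ j, ¬ 3 ∣ κ j) → ∀ γ : ℚ, ∏ j, Q.all j ^ κ j ≠ γ ^ 3)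
    (t : Fin (Q.d + 1) → L) (ht : ∀ i, t i ^ 3 = (Q.all i : L))
    (box : Finset (Idx Q.d h Lb)) (p : Idx Q.d h Lb → ℤ) (c : Idx Q.d h Lb → ℚ) (s : ℕ)
    (h0 : ∑ u ∈ box, (p u : L) * (c u : L) * ∏ i, t i ^ Q.flat.expn u s i = 0)
    (κ : Fin (Q.d + 1) → Fin 3) :
    ∑ u ∈ box with Q.cls3 u s = κ, (p u : ℚ) * (c u * Q.qEt u s) = 0 := by
  rw [Q.sum_prod_cbrt_pow_eq_ev3 t ht] at h0
  have h := Q.classVec3_eq_zero_of_ev3_eq_zero hind t ht box p c s h0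
  exact congrFun h κ

end ThirdPoint

end SetupQ

end Summit.ABC.StewartYu

end
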